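import Mathlib
import Literature.NumberTheory.Transcendental.LinEDS
import Literature.NumberTheory.Transcendental.AssociatorsBarEval
import Literature.NumberTheory.Transcendental.MultipleZetaStuffle
import HarnessLib

/-!
# `KernelModuloPeriodConjecture`, line `Sketch`: E5 — the EDS rows and the fold at a pentagon solution

Crux `FurushoPentagon.KernelModuloPeriodConjecture` (stmt-KontsevichZagierPeriods-15058), line
`Sketch`, registered stub `stub_eval_rowZ_divFold` (E5, "validity of the rows and of the fold at a
pentagon solution") for the kernel-checkable `𝔽₂` rank engine of the linearised extended double
shuffle system (`Literature/NumberTheory/Transcendental/LinEDS.lean`, §5: `rowZ`, `divFold`,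
`evalZ`).

* (a) For a valid row name `(s, t)` (`s` nonempty admissible, `t` nonempty with positive entries)
  the integer row `rowZ (s,t) = Σ_{u ∈ s ∗ t} (-1)^{|u|} e_{bw u} − (-1)^{|s|+|t|} Σ_{w ∈ bw s ш bw t} e_w`
  evaluates to `0` at every group-like solution `φ` of Drinfeld's pentagon equation over a
  commutative `ℚ`-algebra: both halves evaluate to `π_Y(φ)(s) · π_Y(φ)(t)`, the first by
  Furusho's regularised stuffle relation `NCSeries.DrinfeldPentagon.piY_mul_piY_eq_sum_stuffle`
  [Furusho2011, Thm 1.2 / §5] and `π_Y(φ)(u) = (-1)^{|u|} c_{bw u}(φ)`, the second by the shuffle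
  relations of a group-like series (`NCSeries.IsGroupLike.mul_eq_sum_shuffleWord`).
* (b) The fold `divFold` (`e_{y x u} ↦ −Σ_{v ∈ y ш u} e_{x v}`, other words kept) preserves the
  evaluation at a group-like `φ` with `c_y(φ) = 0` on every `f` supported on words beginning with
  `x` or with `y x`: the regularisation identity `c_{y x u}(φ) = −Σ_{v ∈ y ш u} c_{x v}(φ)` is the
  shuffle relation `c_y c_{x u} = Σ_{w ∈ y ш x u} c_w` with `c_y = 0` and
  `y ш (x u) = y x u + x (y ш u)`.

Tools: `evalZ φ` is additive (`evalE5_exists_hom`; no new definition is introduced) and its values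
on `single`, `wordSumZ`, list sums and `Finsupp.sum`s.

References: H. Furusho, Ann. of Math. 174 (2011), Thm 1.2, §5 [Furusho2011]; K. Ihara, M. Kaneko,
D. Zagier, Compos. Math. 142 (2006), §1–2 [IharaKanekoZagier2006].
-/

namespace Summit.KontsevichZagierPeriods.FurushoPentagon.KernelModuloPeriodConjecture

open Literature.NumberTheory.Transcendental

section EvalZ

variable {R : Type*} [Ring R] (φ : NCSeries Bool R)

/-- The evaluation `f ↦ Σ_w f(w) c_w(φ)` of `ℤ⟨x,y⟩` at a series `φ` (`LinEDS.evalZ φ`) is (the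
underlying function of) an additive map. [folklore] -/
theorem evalE5_exists_hom : ∃ E : (List Bool →₀ ℤ) →+ R, ⇑E = LinEDS.evalZ φ :=
  ⟨{ toFun := LinEDS.evalZ φ
     map_zero' := Finsupp.sum_zero_index
     map_add' := fun _ _ =>
       Finsupp.sum_add_index' (fun w => zero_zsmul (φ w)) fun w a b => add_zsmul (φ w) a b }, rfl⟩

/-- `evalZ φ` is additive. [folklore] -/
theorem evalE5_evalZ_add (f g : List Bool →₀ ℤ) :
    LinEDS.evalZ φ (f + g) = LinEDS.evalZ φ f + LinEDS.evalZ φ g := by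
  obtain ⟨E, hE⟩ := evalE5_exists_hom φ
  rw [← hE, map_add]

/-- `evalZ φ` respects subtraction. [folklore] -/
theorem evalE5_evalZ_sub (f g : List Bool →₀ ℤ) :
    LinEDS.evalZ φ (f - g) = LinEDS.evalZ φ f - LinEDS.evalZ φ g := by
  obtain ⟨E, hE⟩ := evalE5_exists_hom φ
  rw [← hE, map_sub]

/-- `evalZ φ` respects negation. [folklore] -/
theorem evalE5_evalZ_neg (f : List Bool →₀ ℤ) : LinEDS.evalZ φ (-f) = -LinEDS.evalZ φ f := by
  obtain ⟨E, hE⟩ := evalE5_exists_hom φ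
  rw [← hE, map_neg]

/-- `evalZ φ` commutes with integer scalars. [folklore] -/
theorem evalE5_evalZ_zsmul (n : ℤ) (f : List Bool →₀ ℤ) :
    LinEDS.evalZ φ (n • f) = n • LinEDS.evalZ φ f := by
  obtain ⟨E, hE⟩ := evalE5_exists_hom φ
  rw [← hE, map_zsmul]

/-- `evalZ φ (n e_w) = n c_w(φ)`. [folklore] -/
theorem evalE5_evalZ_single (w : List Bool) (n : ℤ) :
    LinEDS.evalZ φ (Finsupp.single w n) = n • φ w :=
  Finsupp.sum_single_index (zero_zsmul _)

/-- `evalZ φ` of a list sum is the list sum of the evaluations. [folklore] -/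
theorem evalE5_evalZ_list_sum {ι : Type*} (L : List ι) (g : ι → (List Bool →₀ ℤ)) :
    LinEDS.evalZ φ (L.map g).sum = (L.map fun i => LinEDS.evalZ φ (g i)).sum := by
  obtain ⟨E, hE⟩ := evalE5_exists_hom φ
  rw [← hE, map_list_sum, List.map_map]
  rfl

/-- `evalZ φ (Σ_{w ∈ L} e_w) = Σ_{w ∈ L} c_w(φ)`. [folklore] -/
theorem evalE5_evalZ_wordSumZ (L : List (List Bool)) :
    LinEDS.evalZ φ (LinEDS.wordSumZ L) = (L.map φ).sum := by
  rw [LinEDS.wordSumZ, evalE5_evalZ_list_sum]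
  simp [evalE5_evalZ_single]

/-- `evalZ φ` of a `Finsupp.sum` is the `Finsupp.sum` of the evaluations. [folklore] -/
theorem evalE5_evalZ_finsupp_sum (f : List Bool →₀ ℤ) (g : List Bool → ℤ → (List Bool →₀ ℤ)) :
    LinEDS.evalZ φ (f.sum g) = f.sum fun w n => LinEDS.evalZ φ (g w n) := by
  obtain ⟨E, hE⟩ := evalE5_exists_hom φ
  rw [← hE, map_finsuppSum]

/-- A scalar `(-1)^n ∈ ℤ` acts as multiplication by `(-1)^n ∈ R`. [folklore] -/
theorem evalE5_neg_one_pow_zsmul (n : ℕ) (x : R) : ((-1 : ℤ) ^ n) • x = (-1 : R) ^ n * x := by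
  rw [zsmul_eq_mul, Int.cast_pow, Int.cast_neg, Int.cast_one]

end EvalZ

/-! ### (a) The rows vanish at a pentagon solution -/

/-- A valid row name `(s, t)` has `s` nonempty admissible and `t` nonempty with positive entries.
[folklore] -/
theorem evalE5_validName {k : ℕ} {ν : List ℕ × List ℕ} (h : LinEDS.validName k ν = true) :
    MZV.IsAdmissible ν.1 ∧ ν.1 ≠ [] ∧ (∀ i ∈ ν.2, 1 ≤ i) ∧ ν.2 ≠ [] := by
  obtain ⟨s, t⟩ := ν
  match s, t, h with
  | [], _, h => exact absurd h (by simp [LinEDS.validName])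
  | _ :: _, [], h => exact absurd h (by simp [LinEDS.validName])
  | a :: s, b :: t, h =>
    simp only [LinEDS.validName, Bool.and_eq_true, decide_eq_true_eq, List.all_eq_true] at h
    obtain ⟨⟨⟨⟨⟨ha, hs⟩, hb⟩, ht⟩, -⟩, -⟩ := h
    refine ⟨⟨?_, fun _ => by simpa using ha⟩, List.cons_ne_nil _ _, ?_, List.cons_ne_nil _ _⟩
    · exact List.forall_mem_cons.mpr ⟨by omega, hs⟩
    · exact List.forall_mem_cons.mpr ⟨hb, ht⟩

/-- The harmonic half of the row evaluates to `Σ_{u ∈ s ∗ t} π_Y(φ)(u)`: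
`(-1)^{|u|} c_{bw u}(φ) = π_Y(φ)(u)` as all entries of `u ∈ s ∗ t` are positive.
[cite: Furusho2011, Thm 1.2] -/
theorem evalE5_evalZ_stuffle_half {R : Type*} [CommRing R] (φ : NCSeries Bool R) {s t : List ℕ}
    (hs : ∀ i ∈ s, 1 ≤ i) (ht : ∀ i ∈ t, 1 ≤ i) :
    LinEDS.evalZ φ ((MZV.stuffle s t).map fun u =>
        Finsupp.single (MZV.binaryWord u) ((-1 : ℤ) ^ u.length)).sum =
      ((MZV.stuffle s t).map (NCSeries.piY φ)).sum := by
  rw [evalE5_evalZ_list_sum]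
  refine congrArg List.sum (List.map_congr_left fun u hu => ?_)
  rw [evalE5_evalZ_single, NCSeries.piY_apply_of_forall_pos φ
    (MZV.one_le_of_mem_stuffle s t hs ht u hu), evalE5_neg_one_pow_zsmul]

/-- The shuffle half of the row evaluates to `c_{bw s}(φ) c_{bw t}(φ)` for a group-like `φ`.
[folklore] -/
theorem evalE5_evalZ_shuffle_half {R : Type*} [Ring R] {φ : NCSeries Bool R}
    (hg : NCSeries.IsGroupLike φ) (u v : List Bool) :
    LinEDS.evalZ φ (LinEDS.wordSumZ (MZV.shuffleWord u v)) = φ u * φ v := by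
  rw [evalE5_evalZ_wordSumZ, hg.mul_eq_sum_shuffleWord]

/-- **(a) The integer EDS row of a valid name vanishes at every group-like pentagon solution** over
a commutative `ℚ`-algebra: both halves are `π_Y(φ)(s) π_Y(φ)(t)` (Furusho's regularised double
shuffle for associators). [cite: Furusho2011, Thm 1.2] -/
theorem evalE5_evalZ_rowZ {R : Type*} [CommRing R] [Algebra ℚ R] {φ : NCSeries Bool R}
    (hg : NCSeries.IsGroupLike φ) (h5 : NCSeries.DrinfeldPentagon φ) {k : ℕ} {ν : List ℕ × List ℕ}
    (hν : LinEDS.validName k ν = true) : LinEDS.evalZ φ (LinEDS.rowZ ν) = 0 := by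
  obtain ⟨hs, hs0, ht, ht0⟩ := evalE5_validName hν
  rw [LinEDS.rowZ, evalE5_evalZ_sub, evalE5_evalZ_zsmul, evalE5_evalZ_stuffle_half φ hs.1 ht,
    evalE5_evalZ_shuffle_half hg, ← h5.piY_mul_piY_eq_sum_stuffle hg hs hs0 ht ht0,
    NCSeries.piY_apply_of_forall_pos φ hs.1, NCSeries.piY_apply_of_forall_pos φ ht,
    evalE5_neg_one_pow_zsmul, pow_add]
  ring

/-! ### (b) The fold preserves the evaluation -/

/-- **The regularisation identity** `c_{y x u}(φ) = −Σ_{v ∈ y ш u} c_{x v}(φ)` of a group-like `φ`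
with `c_y(φ) = 0`: the shuffle relation `c_y c_{x u} = Σ_{w ∈ y ш x u} c_w` with
`y ш x u = y x u + x (y ш u)`. [folklore] -/
theorem evalE5_apply_true_false {R : Type*} [Ring R] {φ : NCSeries Bool R}
    (hg : NCSeries.IsGroupLike φ) (h1 : φ [true] = 0) (u : List Bool) :
    φ (true :: false :: u) = -((MZV.shuffleWord [true] u).map fun v => φ (false :: v)).sum := by
  have h := hg.mul_eq_sum_shuffleWord [true] (false :: u)
  simp only [h1, zero_mul, MZV.shuffleWord_cons_cons, MZV.shuffleWord_nil_left, List.map_append,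
    List.map_map, List.map_cons, List.map_nil, List.sum_append, List.sum_cons, List.sum_nil,
    add_zero, Function.comp_def] at h
  exact eq_neg_of_add_eq_zero_left h.symm

/-- The fold of a single word `w` beginning with `x` or with `y x` evaluates to `c_w(φ)` at a
group-like `φ` with `c_y(φ) = 0`. [folklore] -/
theorem evalE5_evalZ_divFoldWord {R : Type*} [Ring R] {φ : NCSeries Bool R}
    (hg : NCSeries.IsGroupLike φ) (h1 : φ [true] = 0) {w : List Bool}
    (hw : w.head? = some false ∨ ∃ u, w = true :: false :: u) :
    LinEDS.evalZ φ (LinEDS.divFoldWord w) = φ w := by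
  rcases hw with hw | ⟨u, rfl⟩
  · obtain ⟨w', rfl⟩ : ∃ w', w = false :: w' := by
      match w, hw with
      | false :: w', _ => exact ⟨w', rfl⟩
    rw [LinEDS.divFoldWord, evalE5_evalZ_single, one_zsmul]
    intro u h
    cases h
  · rw [LinEDS.divFoldWord, evalE5_evalZ_neg, evalE5_evalZ_wordSumZ, evalE5_apply_true_false hg h1,
      List.map_map]
    rfl

/-- **(b) The fold preserves the evaluation** at a group-like `φ` with `c_y(φ) = 0`, on every `f`
supported on words beginning with `x` or with `y x`. [folklore] -/
theorem evalE5_evalZ_divFold {R : Type*} [Ring R] {φ : NCSeries Bool R}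
    (hg : NCSeries.IsGroupLike φ) (h1 : φ [true] = 0) (f : List Bool →₀ ℤ)
    (hf : ∀ w ∈ f.support, w.head? = some false ∨ ∃ u, w = true :: false :: u) :
    LinEDS.evalZ φ (LinEDS.divFold f) = LinEDS.evalZ φ f := by
  rw [LinEDS.divFold, evalE5_evalZ_finsupp_sum]
  refine Finsupp.sum_congr fun w hw => ?_
  rw [evalE5_evalZ_zsmul, evalE5_evalZ_divFoldWord hg h1 (hf w hw)]

/-- **E5 — validity of the rows and of the fold at a pentagon solution** (registered stub of crux
stmt-KontsevichZagierPeriods-15058, line `Sketch`). (a) The integer EDS row of a valid name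
evaluates to `0` at every group-like solution of Drinfeld's pentagon over a commutative
`ℚ`-algebra (both halves are `π_Y(φ)(s) π_Y(φ)(t)`:
`NCSeries.DrinfeldPentagon.piY_mul_piY_eq_sum_stuffle` and the shuffle relations); (b) the fold of
the divergent words preserves the evaluation (regularisation identity
`c_{yxu} = -Σ_{v ∈ y ш u} c_{xv}` from group-likeness and `c_y = 0`).
[cite: Furusho2011, Thm 1.2] -/
theorem stub_eval_rowZ_divFold :
    (∀ (R : Type) [CommRing R] [Algebra ℚ R] (φ : NCSeries Bool R), NCSeries.IsGroupLike φ →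
      NCSeries.DrinfeldPentagon φ → ∀ (k : ℕ) (ν : List ℕ × List ℕ), LinEDS.validName k ν = true →
        LinEDS.evalZ φ (LinEDS.rowZ ν) = 0) ∧
    (∀ (R : Type) [CommRing R] [Algebra ℚ R] (φ : NCSeries Bool R), NCSeries.IsGroupLike φ →
      φ [true] = 0 → ∀ f : List Bool →₀ ℤ,
        (∀ w ∈ f.support, w.head? = some false ∨ ∃ u, w = true :: false :: u) →
          LinEDS.evalZ φ (LinEDS.divFold f) = LinEDS.evalZ φ f) :=
  ⟨fun _ _ _ _ hg h5 _ _ hν => evalE5_evalZ_rowZ hg h5 hν,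
    fun _ _ _ _ hg h1 f hf => evalE5_evalZ_divFold hg h1 f hf⟩

end Summit.KontsevichZagierPeriods.FurushoPentagon.KernelModuloPeriodConjecture
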